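import Summits.ResolutionOfSingularities.ResolutionOfSingularities.Theses.AbhyankarShadows
import Literature.AlgebraicGeometry.Resolution.KnafKuhlmann2005Thm34Stability
import Literature.AlgebraicGeometry.Resolution.AbhyankarInvariants
import Literature.AlgebraicGeometry.Resolution.SeparablyDefectlessDenseDescent
import Literature.AlgebraicGeometry.Resolution.GeneralizedStability

/-!
# `ShadowsUniformize` — negative lemmas III: a place in the completion of an Abhyankar subfunction field has a finitely generated value group

Support (negative) lemmas for the crux `stmt-ResolutionOfSingularities-16756`
(`Summit.ResolutionOfSingularities.ResolutionOfSingularities.Theses.AbhyankarShadows.ShadowsUniformize`,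
route AbhyankarShadows, crux #2 = the TRANSFER half of Teissier's semivaluation conjecture,
arXiv:2311.12456 p. 5, as typed by the planner), filed by the standing disprover (cdisprove, cycle 2;
work file `Cruxes/ShadowsUniformize/Disproof.lean`, §4). Companions: `Negative/IdentityShadow.lean`,
`Negative/LoadBearing.lean`. The file declares NO definition.

## What is attacked

The line `birth` (leads c1, c2) proves the crux by cases and keeps ONE open stub,
`stub_shadowFrameTransfer_core`, on the CORE locus. Lead c2 shrank that locus by a third proved
branch — Knaf–Kuhlmann 2009 Thm. 1.5: places of `K/k` lying in the completion of an ABHYANKAR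
subfunction field `K₀` ("dense-Abhyankar": `∃ K₀ ≤ K` finitely generated over `k` with `O ∩ K₀`
an Abhyankar place of `K₀/k` and `K₀` dense in `K` for `O`) — and added the hypothesis
`hnD : ¬ IsDenseAbhyankar O` to the core stub. How much of the core does this remove?

## Findings (all sorry-free)

* `group_fg_valueGroup_of_isAbhyankarPlace_of_isDenseIn` — a dense-Abhyankar place has a FINITELY
  GENERATED value group: the value group of `(K₀, O ∩ K₀)` is finitely generated (Temkin 2013
  Rem. 2.1.3, tree `valueGroup_fg_of_transcendenceDefect_eq_zero`, the transcendence defect of an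
  Abhyankar place being `0`, tree `transcendenceDefect_comap_eq_zero_of_isAbhyankarPlace`) and
  density makes `vK = vK₀` (`exists_mem_valuation_eq_of_isDenseIn`, read through the tree's
  `unitsValueGroupHom`). No rationality, characteristic or algebraic closedness is used.
* `isCyclic_valueGroup_of_group_fg_of_finrank_le_one`,
  `isCyclic_valueGroup_of_isAbhyankarPlace_of_isDenseIn` — if moreover the value group has
  `Module.finrank ℤ ≤ 1` (the crux's own rendering of rational rank, clause [rank]) it is CYCLIC.
* `not_denseAbhyankar_of_not_isCyclic_of_finrank_le_one` — consequently, for `O ∋ k` of rational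
  rank `≤ 1` with NON-cyclic value group (the core stub's `hndisc`), `hnD` holds automatically:
  in rational rank one the c2 carve-out is EMPTY and the core stub is, there, verbatim the c1 core
  stub — relative local uniformization, given `HasShadows`, at every rational place whose value
  group is a non-discrete subgroup of `ℚ`. That class contains every infinitely singular valuation
  of `k(x, y)` (where local uniformization is Zariski's 1939 theorem, not in the tree) as well as
  the generic open case in `trdeg ≥ 4`.
* `not_denseAbhyankar_of_not_group_fg` — the same for every value group that is not finitely
  generated, in any rational rank.

## Sources
* H. Knaf, F.-V. Kuhlmann, Ann. Sci. ENS 38 (2005) = arXiv:math/0304159, §1 inequality (1) and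
  Thm. 2.1 (Abhyankar places; `vK(x,y) = ⊕ ℤ v xᵢ`).
* M. Temkin, J. Algebra 373 (2013) = arXiv:0804.1554v3, Remark 2.1.3 (value group of a finitely
  generated Abhyankar extension is finitely generated).
* H. Knaf, F.-V. Kuhlmann, Adv. Math. 221 (2009) = arXiv:math/0702856, Thm. 1.5 (the carve-out).
-/

noncomputable section

open Literature.AlgebraicGeometry.Resolution

set_option linter.dupNamespace false -- mandated namespace of this single-conjunct summit

namespace Summit.ResolutionOfSingularities.ResolutionOfSingularities.Theorems.ShadowsUniformize.Negative

variable {k K : Type} [Field k] [Field K] [Algebra k K]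

/-- **Density makes every value of `K` a value of `K₀`.** If `K₀ ≤ K` is dense for `O`
(`IsDenseIn O K₀ ⊤`), every non-zero value of `O` on `K` is the value of a non-zero element of
`K₀`. [folklore] -/
theorem exists_mem_valuation_eq_of_isDenseIn (O : ValuationSubring K) (K₀ : Subfield K)
    (hdense : IsDenseIn O K₀ ⊤) (y : K) (hy0 : y ≠ 0) :
    ∃ z ∈ K₀, z ≠ 0 ∧ O.valuation z = O.valuation y := by
  obtain ⟨z, hz, hlt⟩ := hdense y (Subfield.mem_top y) y (Subfield.mem_top y) hy0
  have hvz : O.valuation z = O.valuation y := by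
    have h := Valuation.map_sub_eq_of_lt_left O.valuation hlt
    rwa [sub_sub_cancel] at h
  refine ⟨z, hz, fun h0 => hy0 ?_, hvz⟩
  rw [h0, map_zero] at hvz
  exact (map_eq_zero O.valuation).mp hvz.symm

/-- **A place in the completion of an Abhyankar subfunction field has a finitely generated value
group.** Let `k ⊆ O` and let `K₀` be an intermediate field of `K/k`, finitely generated over `k`,
on which `O` induces an ABHYANKAR place of `K₀/k` (`IsAbhyankarPlace`, Knaf–Kuhlmann 2005 §1),
and such that `K₀` is DENSE in `K` for `O` (`IsDenseIn O K₀ ⊤`). Then the value group of `O` is a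
finitely generated group: the value group of `(K₀, O ∩ K₀)` is finitely generated (Temkin 2013,
Remark 2.1.3 = tree `valueGroup_fg_of_transcendenceDefect_eq_zero`, the transcendence defect of an
Abhyankar place being `0`, tree `transcendenceDefect_comap_eq_zero_of_isAbhyankarPlace`), and by
density it is all of the value group of `K`. No rationality, characteristic or algebraic
closedness is used. [cite: KnafKuhlmann2005, Section 1 (inequality (1)) and Thm. 2.1] -/
theorem group_fg_valueGroup_of_isAbhyankarPlace_of_isDenseIn (O : ValuationSubring K)
    (hk : ∀ c : k, algebraMap k K c ∈ O) (K₀ : IntermediateField k K) (hK₀ : K₀.FG)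
    (hA : IsAbhyankarPlace O (algebraMap k K).fieldRange K₀.toSubfield)
    (hdense : IsDenseIn O K₀.toSubfield ⊤) :
    Group.FG (O.ValueGroup)ˣ := by
  classical
  obtain ⟨S, hS⟩ := hK₀
  set k' : Subfield K := (algebraMap k K).fieldRange with hk'def
  set M : IntermediateField k' K := IntermediateField.adjoin k' (S : Set K) with hM
  have hcl : K₀.toSubfield = Subfield.closure ((k' : Set K) ∪ (S : Set K)) := by
    rw [← hS, hk'def, RingHom.coe_fieldRange]
    rfl
  have hMF : ∀ z, z ∈ M ↔ z ∈ K₀.toSubfield := by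
    intro z
    rw [hM, mem_adjoin_subfield_iff, hcl]
  have hfgM : (⊤ : IntermediateField k' M).FG :=
    IntermediateField.fg_top_iff.mpr
      (IntermediateField.essFiniteType_iff.mpr (IntermediateField.fg_adjoin_finset S))
  have hKV : ((k' : Subfield K) : Set K) ⊆ O := by
    rintro _ ⟨c, rfl⟩
    exact hk c
  have hk'O : ∀ c : k', algebraMap k' M c ∈ O.comap (algebraMap M K) :=
    algebraMap_mem_comap_intermediateField O M hKV
  have hD : transcendenceDefect k' (O.comap (algebraMap M K)) hk'O = 0 :=
    transcendenceDefect_comap_eq_zero_of_isAbhyankarPlace O M hMF hKV hfgM hA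
  haveI : Group.FG ((O.comap (algebraMap M K)).ValueGroup)ˣ :=
    valueGroup_fg_of_transcendenceDefect_eq_zero _ hfgM hk'O hD
  have hsurj : Function.Surjective (unitsValueGroupHom M O) := by
    rw [← MonoidHom.range_eq_top, range_unitsValueGroupHom]
    refine eq_top_iff.mpr fun γ _ => ?_
    rw [mem_valueSubgroup_iff]
    obtain ⟨y, hy⟩ := O.valuation_surjective (γ : O.ValueGroup)
    have hy0 : y ≠ 0 := fun h => γ.ne_zero (by rw [← hy, h, map_zero])
    obtain ⟨z, hz, hz0, hvz⟩ := exists_mem_valuation_eq_of_isDenseIn O K₀.toSubfield hdense y hy0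
    refine ⟨⟨z, (hMF z).mpr hz⟩, fun h0 => hz0 (congrArg Subtype.val h0), ?_⟩
    rw [← hy, ← hvz]
    rfl
  exact Group.fg_of_surjective hsurj

/-- **Finitely generated value group of rational rank `≤ 1` is cyclic.** For a valuation ring
`O` whose value group is a finitely generated group with `Module.finrank ℤ ≤ 1` (the crux's
rendering of "rational rank `≤ 1`"), the value group is cyclic: a discrete place of rank `≤ 1`.
[folklore] -/
theorem isCyclic_valueGroup_of_group_fg_of_finrank_le_one (O : ValuationSubring K)
    [Group.FG (O.ValueGroup)ˣ] (h : Module.finrank ℤ (Additive (O.ValueGroup)ˣ) ≤ 1) :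
    IsCyclic (O.ValueGroup)ˣ := by
  haveI : Module.Finite ℤ (Additive (O.ValueGroup)ˣ) :=
    Module.Finite.iff_addGroup_fg.mpr inferInstance
  haveI : Module.Free ℤ (Additive (O.ValueGroup)ˣ) := Module.free_of_finite_type_torsion_free'
  obtain ⟨v, hv⟩ := finrank_le_one_iff.mp h
  rw [← isAddCyclic_additive_iff]
  refine ⟨⟨v, fun w => ?_⟩⟩
  obtain ⟨c, hc⟩ := hv w
  exact ⟨c, hc⟩

/-- **The dense-Abhyankar locus of rational rank `≤ 1` is the discrete locus.** If `k ⊆ O`, the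
value group of `O` has `Module.finrank ℤ ≤ 1`, and `O` lies in the completion of an Abhyankar
subfunction field `K₀` of `K/k` (`K₀` finitely generated over `k`, `O ∩ K₀` an Abhyankar place of
`K₀/k`, `K₀` dense in `K`), then the value group of `O` is CYCLIC.
[cite: KnafKuhlmann2005, Section 1 (inequality (1)) and Thm. 2.1] -/
theorem isCyclic_valueGroup_of_isAbhyankarPlace_of_isDenseIn (O : ValuationSubring K)
    (hk : ∀ c : k, algebraMap k K c ∈ O) (K₀ : IntermediateField k K) (hK₀ : K₀.FG)
    (hA : IsAbhyankarPlace O (algebraMap k K).fieldRange K₀.toSubfield)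
    (hdense : IsDenseIn O K₀.toSubfield ⊤)
    (hr : Module.finrank ℤ (Additive (O.ValueGroup)ˣ) ≤ 1) : IsCyclic (O.ValueGroup)ˣ := by
  haveI := group_fg_valueGroup_of_isAbhyankarPlace_of_isDenseIn O hk K₀ hK₀ hA hdense
  exact isCyclic_valueGroup_of_group_fg_of_finrank_le_one O hr

/-- **Line `birth` (lead c2), core stub: `hnD` is implied by `hndisc` in rational rank `≤ 1`.**
The c2 reshape added to `stub_shadowFrameTransfer_core` the hypothesis
`hnD : ¬ IsDenseAbhyankar O`, i.e. `¬ ∃ K₀, K₀.FG ∧ IsAbhyankarPlace O k K₀ ∧ IsDenseIn O K₀ ⊤`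
(written out here; the skeleton's `IsDenseAbhyankar` unfolds to it). For every `O ∋ k` whose value
group has `Module.finrank ℤ ≤ 1` and is NOT cyclic (the stub's `hndisc`), `hnD` holds
automatically: the dense-Abhyankar carve-out (Knaf–Kuhlmann 2009 Thm. 1.5) removes NOTHING from
the core locus in rational rank one. In particular every rational place of `K/k` with value group
a non-discrete subgroup of `ℚ` — all infinitely singular valuations of `k(x, y)` (where local
uniformization is classical but not in the tree) and the generic open case in `trdeg ≥ 4` — stays
in the core stub, whose content there is unchanged from cycle c1: relative local uniformization
given `HasShadows`. [cite: KnafKuhlmann2005, Section 1 (inequality (1)) and Thm. 2.1] -/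
theorem not_denseAbhyankar_of_not_isCyclic_of_finrank_le_one (O : ValuationSubring K)
    (hk : ∀ c : k, algebraMap k K c ∈ O) (hr : Module.finrank ℤ (Additive (O.ValueGroup)ˣ) ≤ 1)
    (hndisc : ¬ IsCyclic (O.ValueGroup)ˣ) :
    ¬ ∃ K₀ : IntermediateField k K, K₀.FG ∧
      IsAbhyankarPlace O (algebraMap k K).fieldRange K₀.toSubfield ∧ IsDenseIn O K₀.toSubfield ⊤ :=
  fun ⟨K₀, hK₀, hA, hdense⟩ =>
    hndisc (isCyclic_valueGroup_of_isAbhyankarPlace_of_isDenseIn O hk K₀ hK₀ hA hdense hr)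

/-- **The same, for value groups that are not finitely generated (any rational rank).** If the
value group of `O ∋ k` is not a finitely generated group — e.g. `ℤ[1/p]`, `ℤ + ℤ√2 + ⋯` with
unbounded denominators, any rank-one non-discrete subgroup of `ℚ` — then `O` is not in the
completion of any Abhyankar subfunction field: `hnD` of the core stub holds for free there too.
[cite: KnafKuhlmann2005, Section 1 (inequality (1)) and Thm. 2.1] -/
theorem not_denseAbhyankar_of_not_group_fg (O : ValuationSubring K)
    (hk : ∀ c : k, algebraMap k K c ∈ O) (hnfg : ¬ Group.FG (O.ValueGroup)ˣ) :
    ¬ ∃ K₀ : IntermediateField k K, K₀.FG ∧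
      IsAbhyankarPlace O (algebraMap k K).fieldRange K₀.toSubfield ∧ IsDenseIn O K₀.toSubfield ⊤ :=
  fun ⟨K₀, hK₀, hA, hdense⟩ =>
    hnfg (group_fg_valueGroup_of_isAbhyankarPlace_of_isDenseIn O hk K₀ hK₀ hA hdense)

end Summit.ResolutionOfSingularities.ResolutionOfSingularities.Theorems.ShadowsUniformize.Negative

end
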